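import Summits.AtomisticToContinuum.FouriersLaw.Theses.EmbeddedDrudeMourre
import Literature.MathematicalPhysics.KineticTheory.ChainReflection
import Literature.MathematicalPhysics.KineticTheory.LangevinChainDynkin

/-!
# `FiniteResponseOfUnique` (stmt-AtomisticToContinuum-0717): oddness of the response function, and the Kubo-formula glue

`--supports` helper file (route decl
`Summit.AtomisticToContinuum.FouriersLaw.Theses.EmbeddedDrudeMourre.FiniteResponseOfUnique`):

* §8 under weak-NESS uniqueness the response function `δ ↦ J_N(T+δ/2, T-δ/2)` is odd
  (left–right reflection of the chain, `Literature/.../ChainReflection.lean`), so the existence of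
  the ONE-SIDED limit `δ → 0⁺` of the response quotient already gives the item's two-sided limit
  (`tendsto_response_of_tendsto_right`).
* §9 the finite-volume Kubo formula in the tree's language (`OscillatorChain.KuboFormula`, the
  statement of Bonetto–Lebowitz–Rey-Bellet 2000 (32), NOT a named fact) for the family at `(T, N)`
  implies the item's conclusion at `(T, N)` (`exists_tendsto_response_of_kuboFormula`), hence a
  `KuboIdentity`-shaped hypothesis (item stmt-AtomisticToContinuum-3967 of route OpenChainMazur)
  implies `FiniteResponseOfUnique` (`finiteResponseOfUnique_of_kuboFormula`).
-/

noncomputable section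

namespace Summit.AtomisticToContinuum.FouriersLaw.Theorems.FiniteResponse

open MeasureTheory Filter Topology
open scoped NNReal
open Literature.MathematicalPhysics.KineticTheory.HeatConduction

/-! ## §8 The response function is odd: a one-sided limit suffices -/

section Oddness

variable {ω₂ lam β γ : ℝ}

/-- **Oddness of the response function under uniqueness**: for `|δ| < 2T`,
`J_N(T - δ/2, T + δ/2) = -J_N(T + δ/2, T - δ/2)` (left–right reflection of the chain,
`pinnedChain_totalCurrent_eq_neg_of_unique`). [folklore] -/
theorem totalCurrent_family_neg {N : ℕ} {T : ℝ}
    (huniq : ∀ (T_L T_R : ℝ), 0 < T_L → 0 < T_R → ∀ μ ν : Measure (PhaseSpace N),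
      (pinnedChain ω₂ lam β γ).IsSteadyState N T_L T_R μ →
        (pinnedChain ω₂ lam β γ).IsSteadyState N T_L T_R ν → μ = ν)
    (μ : ℝ → ℝ → Measure (PhaseSpace N))
    (hμ : ∀ T_L T_R : ℝ, 0 < T_L → 0 < T_R →
      (pinnedChain ω₂ lam β γ).IsSteadyState N T_L T_R (μ T_L T_R))
    {δ : ℝ} (hδ : |δ| < 2 * T) :
    (pinnedChain ω₂ lam β γ).totalCurrent (μ (T + -δ / 2) (T - -δ / 2)) =
      -(pinnedChain ω₂ lam β γ).totalCurrent (μ (T + δ / 2) (T - δ / 2)) := by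
  have hδ' := abs_lt.1 hδ
  have hL : 0 < T + δ / 2 := by linarith
  have hR : 0 < T - δ / 2 := by linarith
  have h1 : T + -δ / 2 = T - δ / 2 := by ring
  have h2 : T - -δ / 2 = T + δ / 2 := by ring
  rw [h1, h2]
  exact pinnedChain_totalCurrent_eq_neg_of_unique (huniq _ _ hR hL) (hμ _ _ hL hR) (hμ _ _ hR hL)

/-- **A one-sided response limit suffices**: under uniqueness the response quotient
`δ ↦ J_N(T+δ/2, T-δ/2)/δ` is even on `0 < |δ| < 2T`, so its limit along `δ → 0⁺` is its limit
along `δ → 0, δ ≠ 0`. [folklore] -/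
theorem tendsto_response_of_tendsto_right {N : ℕ} {T : ℝ} (hT : 0 < T)
    (huniq : ∀ (T_L T_R : ℝ), 0 < T_L → 0 < T_R → ∀ μ ν : Measure (PhaseSpace N),
      (pinnedChain ω₂ lam β γ).IsSteadyState N T_L T_R μ →
        (pinnedChain ω₂ lam β γ).IsSteadyState N T_L T_R ν → μ = ν)
    (μ : ℝ → ℝ → Measure (PhaseSpace N))
    (hμ : ∀ T_L T_R : ℝ, 0 < T_L → 0 < T_R →
      (pinnedChain ω₂ lam β γ).IsSteadyState N T_L T_R (μ T_L T_R))
    {D : ℝ} (hright : Tendsto (fun δ : ℝ =>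
      (pinnedChain ω₂ lam β γ).totalCurrent (μ (T + δ / 2) (T - δ / 2)) / δ) (𝓝[>] 0) (𝓝 D)) :
    Tendsto (fun δ : ℝ =>
      (pinnedChain ω₂ lam β γ).totalCurrent (μ (T + δ / 2) (T - δ / 2)) / δ) (𝓝[≠] 0) (𝓝 D) := by
  set F : ℝ → ℝ := fun δ =>
    (pinnedChain ω₂ lam β γ).totalCurrent (μ (T + δ / 2) (T - δ / 2)) / δ with hF
  -- evenness near `0`
  have heven : ∀ δ : ℝ, |δ| < 2 * T → F (-δ) = F δ := by
    intro δ hδ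
    simp only [hF]
    rw [totalCurrent_family_neg huniq μ hμ hδ, neg_div_neg_eq]
  -- the left limit from the right limit
  have hleft : Tendsto F (𝓝[<] 0) (𝓝 D) := by
    have hneg : Tendsto (fun δ : ℝ => -δ) (𝓝[<] (0 : ℝ)) (𝓝[>] 0) := by
      simpa using (tendsto_neg_nhdsLT (a := (0 : ℝ)))
    have hcomp : Tendsto (F ∘ fun δ : ℝ => -δ) (𝓝[<] 0) (𝓝 D) := hright.comp hneg
    refine hcomp.congr' ?_
    have hmem : Set.Ioo (-(2 * T)) 0 ∈ 𝓝[<] (0 : ℝ) := Ioo_mem_nhdsLT (by linarith)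
    filter_upwards [hmem] with δ hδ
    simp only [Function.comp_apply]
    exact heven δ (abs_lt.2 ⟨hδ.1, by linarith [hδ.2]⟩)
  rw [← nhdsLT_sup_nhdsGT]
  exact hleft.sup hright

end Oddness

/-! ## §9 The Kubo formula in the tree's language implies the item's conclusion -/

section Kubo

/-- **`KuboFormula` at `(T, N)` ⇒ the response limit at `(T, N)`**: the finite-volume Kubo formula
(`OscillatorChain.KuboFormula`, BLR 2000 (32) as a statement) gives the per-bond limits for the
bonds `(i, i+1)`; the last site carries no bond current; summing, the response limit of the total
current exists. Any chain `P`, any equilibrium semigroup `S₀`. [folklore] -/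
theorem exists_tendsto_response_of_kuboFormula (P : OscillatorChain) {N : ℕ} (T : ℝ)
    (μ : ℝ → ℝ → Measure (PhaseSpace N)) (S₀ : LangevinChainSemigroup P N T T)
    (h : P.KuboFormula N T μ S₀) :
    ∃ D : ℝ, Tendsto (fun δ : ℝ => P.totalCurrent (μ (T + δ / 2) (T - δ / 2)) / δ)
      (𝓝[≠] 0) (𝓝 D) := by
  classical
  -- per-bond limits: Kubo for genuine bonds, `0` for the last site
  set c : Fin N → ℝ := fun i => if hi : i.val + 1 < N then
    (1 / T ^ 2) * ∫ t in Set.Ioi (0 : ℝ),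
      ∫ z, P.bondCurrent N i z * S₀.act t.toNNReal (P.bondCurrent N i) z ∂(μ T T) else 0 with hc
  refine ⟨∑ i, c i, ?_⟩
  have hfun : (fun δ : ℝ => P.totalCurrent (μ (T + δ / 2) (T - δ / 2)) / δ) =
      fun δ : ℝ => ∑ i : Fin N, (∫ x, P.bondCurrent N i x ∂(μ (T + δ / 2) (T - δ / 2))) / δ := by
    funext δ
    simp only [OscillatorChain.totalCurrent, Finset.sum_div]
  rw [hfun]
  refine tendsto_finsetSum _ fun i _ => ?_
  by_cases hi : i.val + 1 < N
  · simp only [hc, dif_pos hi]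
    exact (h i hi).2
  · simp only [hc, dif_neg hi]
    have h0 : ∀ δ : ℝ, (∫ x, P.bondCurrent N i x ∂(μ (T + δ / 2) (T - δ / 2))) / δ = 0 := by
      intro δ
      simp [P.bondCurrent_eq_zero_of_last N i (by have := i.isLt; omega)]
    simp only [h0]
    exact tendsto_const_nhds

/-- **A `KuboIdentity`-shaped hypothesis implies `FiniteResponseOfUnique`** (cf. item
stmt-AtomisticToContinuum-3967 of route OpenChainMazur): if under uniqueness the Kubo formula holds
for every family, `T > 0` and `N ≥ 1` (with the constructed equilibrium semigroup), then the item
holds (`N = 0`: no current). [folklore] -/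
theorem finiteResponseOfUnique_of_kuboFormula
    (hK : ∀ ω₂ lam β γ : ℝ, ∀ (hω : 0 < ω₂) (hl : 0 < lam) (hβ : 0 < β) (hγ : 0 < γ),
      (∀ (N : ℕ) (T_L T_R : ℝ), 0 < T_L → 0 < T_R → ∀ μ ν : Measure (PhaseSpace N),
        (pinnedChain ω₂ lam β γ).IsSteadyState N T_L T_R μ →
          (pinnedChain ω₂ lam β γ).IsSteadyState N T_L T_R ν → μ = ν) →
      ∀ μ : (N : ℕ) → ℝ → ℝ → Measure (PhaseSpace N),
        (∀ (N : ℕ) (T_L T_R : ℝ), 0 < T_L → 0 < T_R →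
          (pinnedChain ω₂ lam β γ).IsSteadyState N T_L T_R (μ N T_L T_R)) →
        ∀ T : ℝ, ∀ (hT : 0 < T), ∀ N : ℕ, ∀ (hN : 0 < N),
          (pinnedChain ω₂ lam β γ).KuboFormula N T (μ N)
            (pinnedChainSemigroup hω hl.le hβ.le hγ.le hN hT.le hT.le)) :
    Summit.AtomisticToContinuum.FouriersLaw.Theses.EmbeddedDrudeMourre.FiniteResponseOfUnique := by
  intro ω₂ lam β γ hω hl hβ hγ huniq μ hμ T hT N
  rcases Nat.eq_zero_or_pos N with rfl | hN
  · refine ⟨0, ?_⟩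
    simp only [OscillatorChain.totalCurrent_zero, zero_div]
    exact tendsto_const_nhds
  · exact exists_tendsto_response_of_kuboFormula _ T (μ N) _ (hK ω₂ lam β γ hω hl hβ hγ huniq μ hμ T hT N hN)

end Kubo

end Summit.AtomisticToContinuum.FouriersLaw.Theorems.FiniteResponse

end
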